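import Mathlib
import Summits.Ventures.PercRepro.TriangleCapRegularCellGap

/-!
# PercRepro — THE TOP OF THE REGULAR CELL: `bottomReg + ℓ D (ℓ − 1) / 2`, THE ALL-SINGLETON ROWS
(p3, gen 54; part 295)

In the regular cell `t = ℓ D` a row of size `k` costs `k (ℓ − k) ≤ (ℓ − 1) k`, so the row excess is at most
`(ℓ − 1) Σ k = ℓ D (ℓ − 1)`, with equality for the `ℓ D` singleton rows (every off-edge at its own leaf: the
`(ℓ − 1)`-carrier round robin of part 268).  THEOREM (`regular_cell_top`, `2 ≤ ℓ ≤ D`): every band value of the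
regular cell is at most `bottomReg ℓ D + ℓ D (ℓ − 1) / 2`, and this value is attained — with parts 290–291 the
regular cell is `{bottomReg} ∪ {bottomReg + ℓ − 1} ∪ (a subset of `[bottomReg + 2ℓ − 4, bottomReg + ℓD(ℓ−1)/2]`
containing both ends)`.  Axioms: standard.
-/

namespace PercRepro

namespace TriangleCap

namespace C047

open Finset

/-- The excess of a row is at most `(ℓ − 1)` times its size: `k (ℓ − k) ≤ (ℓ − 1) k` for `1 ≤ k`. -/
theorem excess_le_pred_mul (k ℓ : ℕ) (hk : 1 ≤ k) : k * (ℓ - k) ≤ (ℓ - 1) * k := by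
  rw [mul_comm (ℓ - 1) k]
  exact Nat.mul_le_mul_left k (by omega)

/-- **THE TOP OF THE REGULAR CELL:** for `2 ≤ ℓ ≤ D`, `t = ℓ D`, `2 t ≤ s`, every band value `j` of a triangle-free
graph on `ℓ + 1 + (s − t)` vertices with `s` edges, a vertex of degree `s − t` and every off-degree `≤ D` satisfies
`2 j ≤ 2 bottomReg ℓ D + ℓ D (ℓ − 1)`, and the value `bottomReg ℓ D + ℓ D (ℓ − 1) / 2` is attained. -/
theorem regular_cell_top (s t ℓ D : ℕ) (hℓ : 2 ≤ ℓ) (hℓD : ℓ ≤ D) (ht : t = ℓ * D) (hs : 2 * t ≤ s) :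
    (∀ j, (∃ (H : SimpleGraph (Fin (ℓ + 1 + (s - t)))) (_ : DecidableRel H.Adj), H.CliqueFree 3 ∧
        H.edgeFinset.card = s ∧ ∃ w, deg H w + t = s ∧ (∀ v, offDeg H w v ≤ D) ∧
          ∑ v, deg H v * deg H v + 2 * (t * (s - t - 1)) + 2 * j = s * (s + 1)) →
      2 * j ≤ 2 * bottomReg ℓ D + ℓ * D * (ℓ - 1)) ∧
    (∃ (H : SimpleGraph (Fin (ℓ + 1 + (s - t)))) (_ : DecidableRel H.Adj), H.CliqueFree 3 ∧
        H.edgeFinset.card = s ∧ ∃ w, deg H w + t = s ∧ (∀ v, offDeg H w v ≤ D) ∧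
          ∑ v, deg H v * deg H v + 2 * (t * (s - t - 1)) + 2 * (bottomReg ℓ D + ℓ * D * (ℓ - 1) / 2) =
            s * (s + 1)) := by
  subst ht
  have hb := two_mul_bottomReg ℓ D (by omega) hℓD
  refine ⟨fun j hj => ?_, ?_⟩
  · obtain ⟨N, k, hk, hsum, hid⟩ := (regular_cell_iff s (ℓ * D) ℓ D j (by omega) hℓD rfl hs).mp hj
    have hup : ∑ m ∈ range N, k m * (ℓ - k m) ≤ ℓ * D * (ℓ - 1) := by
      calc ∑ m ∈ range N, k m * (ℓ - k m) ≤ ∑ m ∈ range N, (ℓ - 1) * k m :=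
            sum_le_sum (fun m hm => excess_le_pred_mul (k m) ℓ (hk m (mem_range.mp hm)).1)
        _ = (ℓ - 1) * ∑ m ∈ range N, k m := by rw [mul_sum]
        _ = ℓ * D * (ℓ - 1) := by rw [hsum]; ring
    omega
  · -- the all-singleton rows: `ℓ D` rows of size `1`
    have hev : Even (ℓ * D * (ℓ - 1)) := by
      rcases Nat.even_or_odd ℓ with h | h
      · exact (h.mul_right D).mul_right (ℓ - 1)
      · have : Even (ℓ - 1) := by
          obtain ⟨a, ha⟩ := h
          exact ⟨a, by omega⟩
        exact this.mul_left (ℓ * D)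
    have h2 : 2 * (ℓ * D * (ℓ - 1) / 2) = ℓ * D * (ℓ - 1) := Nat.two_mul_div_two_of_even hev
    apply (regular_cell_iff s (ℓ * D) ℓ D (bottomReg ℓ D + ℓ * D * (ℓ - 1) / 2) (by omega) hℓD rfl hs).mpr
    refine ⟨ℓ * D, fun _ => 1, fun m _ => ⟨le_rfl, show 1 ≤ ℓ by omega⟩,
      by rw [sum_const, card_range, smul_eq_mul, mul_one], ?_⟩
    rw [sum_const, card_range, smul_eq_mul, one_mul]
    omega

end C047

end TriangleCap

end PercRepro
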